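import Literature.NumberTheory.LFunctions.WeilExplicit
import Literature.NumberTheory.LFunctions.WeilExplicitProofs
import Literature.NumberTheory.LFunctions.WeilArchimedeanPositivityProofs
import Summits.RiemannHypothesis.RiemannHypothesis.Theorems.SignConeFakeWeightReduction

/-!
# Stub `stub_certificateSuffices` for crux `SignCone.SignConeOscillatory` (stmt-RiemannHypothesis-16302), line Sketch

A spectral certificate forces the unit-slack sign-cone inequality. Write `kᵢ = gᵢ ⋆ g̃ᵢ`
(`weilConv (g i) (weilReflect (g i))`), `F = Σᵢ kᵢ`, `W_ar = weilPolarTerm + weilArchTerm` and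
`P_c(K) = Σ_{2 ≤ n ≤ N} c n · 2 Re K(log n)/√n`. If a non-negative weight `c` and a measure `σ` satisfy
`Re W_ar(kᵢ) + ‖gᵢ‖₂² − P_c(kᵢ) = ∫ |ĝᵢ(1/2 + iy)|² dσ(y)` for every `i`, then for node-nonnegative `F`
(`Re F(log n) ≥ 0`, `n ≥ 2`): `Re W_ar(F) + Re F(0) = Σᵢ ∫ |ĝᵢ|² dσ + P_c(F) ≥ 0`.

Proof: elementary real bookkeeping. `W_ar(F) = Σᵢ W_ar(kᵢ)` (`weilArchPolar_finset_sum`),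
`F(0) = Σᵢ ‖gᵢ‖₂²` (`weilConv_weilReflect_apply_zero`), `Σᵢ P_c(kᵢ) = P_c(F) ≥ 0` termwise
(`c n ≥ 0`, `Re F(log n) ≥ 0`, `√n ≥ 0`), and `∫ |ĝᵢ|² dσ ≥ 0` (`integral_nonneg`). Summing the
certificate identities over `i` gives the claim.
-/

noncomputable section
set_option linter.dupNamespace false
open scoped BigOperators ComplexConjugate Real
open Complex MeasureTheory Set Filter

namespace Summit.RiemannHypothesis.RiemannHypothesis.Theorems.SignConeOscillatory

open Literature.NumberTheory.LFunctions
open Summit.RiemannHypothesis.RiemannHypothesis.Theorems.SignCone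

/-- STUB (a certificate forces the unit-slack inequality). If a non-negative weight `c` and a positive measure
`σ` satisfy `Re W_ar(kᵢ) + ‖gᵢ‖₂² − P_c(kᵢ) = ∫ |ĝᵢ|² dσ` for every `kᵢ = gᵢ ⋆ g̃ᵢ`, then for the node-nonnegative
sum `F = Σᵢ kᵢ`: `Re W_ar(F) + Re F(0) = Σᵢ ∫|ĝᵢ|² dσ + P_c(F) ≥ 0` (additivity `weilArchPolar_finset_sum`,
`F(0) = Σ ‖gᵢ‖₂²` by `weilConv_weilReflect_apply_zero`, and `P_c(F) = Σₙ cₙ n^{-1/2} 2 Re F(log n) ≥ 0`). -/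
theorem stub_certificateSuffices :
    ∀ (N : ℕ) (c : ℕ → ℝ) (σ : Measure ℝ) (k : ℕ) (g : Fin k → ℝ → ℂ),
      (∀ n, 0 ≤ c n) → (∀ i, IsWeilTest (g i)) →
      (∀ i, (weilPolarTerm (weilConv (g i) (weilReflect (g i)))
              + weilArchTerm (weilConv (g i) (weilReflect (g i)))).re + (∫ t : ℝ, ‖g i t‖ ^ 2)
            - ∑ n ∈ Finset.Icc 2 N,
                c n * (2 * (weilConv (g i) (weilReflect (g i)) (Real.log n)).re) / Real.sqrt n
          = ∫ y : ℝ, ‖weilMellin (g i) (1 / 2 + y * I)‖ ^ 2 ∂σ) →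
      (∀ n : ℕ, 2 ≤ n → 0 ≤ (∑ i, weilConv (g i) (weilReflect (g i)) (Real.log n)).re) →
      -((fun t : ℝ => ∑ i, weilConv (g i) (weilReflect (g i)) t) 0).re ≤
        (weilPolarTerm (fun t : ℝ => ∑ i, weilConv (g i) (weilReflect (g i)) t)
          + weilArchTerm (fun t : ℝ => ∑ i, weilConv (g i) (weilReflect (g i)) t)).re := by
  intro N c σ k g hc hg hcert hn
  -- each `kᵢ = gᵢ ⋆ g̃ᵢ` is a Weil test
  have hGi : ∀ i, IsWeilTest (weilConv (g i) (weilReflect (g i))) := fun i =>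
    (hg i).weilConv (hg i).weilReflect
  -- additivity of `W_ar` over the finite sum
  have hA : weilPolarTerm (fun t : ℝ => ∑ i, weilConv (g i) (weilReflect (g i)) t)
      + weilArchTerm (fun t : ℝ => ∑ i, weilConv (g i) (weilReflect (g i)) t) =
      ∑ i, (weilPolarTerm (weilConv (g i) (weilReflect (g i)))
        + weilArchTerm (weilConv (g i) (weilReflect (g i)))) :=
    weilArchPolar_finset_sum _ fun i _ => hGi i
  have hAre : (weilPolarTerm (fun t : ℝ => ∑ i, weilConv (g i) (weilReflect (g i)) t)
      + weilArchTerm (fun t : ℝ => ∑ i, weilConv (g i) (weilReflect (g i)) t)).re =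
      ∑ i, (weilPolarTerm (weilConv (g i) (weilReflect (g i)))
        + weilArchTerm (weilConv (g i) (weilReflect (g i)))).re := by
    rw [hA, Complex.re_sum]
  -- `F(0) = Σᵢ ‖gᵢ‖₂²`
  have h0 : ((fun t : ℝ => ∑ i, weilConv (g i) (weilReflect (g i)) t) 0).re =
      ∑ i, ∫ t : ℝ, ‖g i t‖ ^ 2 := by
    show (∑ i, weilConv (g i) (weilReflect (g i)) 0).re = _
    simp only [weilConv_weilReflect_apply_zero, Complex.re_sum, Complex.ofReal_re]
  -- the spectral side is non-negative
  have hI : 0 ≤ ∑ i, ∫ y : ℝ, ‖weilMellin (g i) (1 / 2 + y * I)‖ ^ 2 ∂σ :=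
    Finset.sum_nonneg fun i _ => integral_nonneg fun y => by positivity
  -- `Σᵢ P_c(kᵢ) = P_c(F) ≥ 0` termwise on the sign cone
  have hP : 0 ≤ ∑ i, ∑ n ∈ Finset.Icc 2 N,
      c n * (2 * (weilConv (g i) (weilReflect (g i)) (Real.log n)).re) / Real.sqrt n := by
    rw [Finset.sum_comm]
    refine Finset.sum_nonneg fun n hn' => ?_
    have h2n : 2 ≤ n := (Finset.mem_Icc.1 hn').1
    have hswap : ∑ i, c n * (2 * (weilConv (g i) (weilReflect (g i)) (Real.log n)).re) / Real.sqrt n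
        = c n * (2 * (∑ i, weilConv (g i) (weilReflect (g i)) (Real.log n)).re) / Real.sqrt n := by
      rw [Complex.re_sum, Finset.mul_sum, Finset.mul_sum, Finset.sum_div]
    rw [hswap]
    exact div_nonneg (mul_nonneg (hc n) (mul_nonneg zero_le_two (hn n h2n))) (Real.sqrt_nonneg _)
  -- sum the certificate identities over `i`
  have hS : ∑ i, ((weilPolarTerm (weilConv (g i) (weilReflect (g i)))
        + weilArchTerm (weilConv (g i) (weilReflect (g i)))).re + (∫ t : ℝ, ‖g i t‖ ^ 2)
      - ∑ n ∈ Finset.Icc 2 N,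
          c n * (2 * (weilConv (g i) (weilReflect (g i)) (Real.log n)).re) / Real.sqrt n)
      = ∑ i, ∫ y : ℝ, ‖weilMellin (g i) (1 / 2 + y * I)‖ ^ 2 ∂σ :=
    Finset.sum_congr rfl fun i _ => hcert i
  rw [Finset.sum_sub_distrib, Finset.sum_add_distrib] at hS
  rw [h0, hAre]
  linarith

end Summit.RiemannHypothesis.RiemannHypothesis.Theorems.SignConeOscillatory

end
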